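import Literature.NumberTheory.GaloisRepresentations.LubinTateComparisonAddPoints
import Literature.NumberTheory.GaloisRepresentations.LubinTateMultiplicativeGroup
import HarnessLib

/-!
# `q = 2`: `ϑ(−2) = −π'`, `ϑ(−2 − x) = −π' − ϑ(x)`, and the transport of Coleman's trace-zero
# condition from `F_{f'}` to `Ĝ_m` — `Σ_{w² = 1} (h ∘ ϑ)(εw − 1) = 0` at all `2`-power roots of unity

Topic `NumberTheory/GaloisRepresentations`; namespace `Literature.NumberTheory.GaloisRepresentations`.

De Shalit, *Iwasawa theory of elliptic curves with complex multiplication* (1987), I.3.2–3.3: the measure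
`μ_β` of a norm-coherent unit is read on `Ĝ_m` through `θ : Ĝ_m ≃ F_f` over `𝒪̂_{K^nr}` ((3)–(5)), and it is
supported on `ℤ_p^×` because of the Euler-factor identity (7) ⟺ (7′):
`P̃(S) = P(S) − p⁻¹ Σ_{ς^p = 1} P(ς(1+S) − 1)`.  At `p = 2` both sides are REFLECTIONS: on `Ĝ_m` the
non-trivial `2`-division point is `ς − 1 = −2` and `S [+] (−2) = −2 − S` (`1 + S ↦ −(1 + S)`); on the
Lubin–Tate group of `f' = π'X + X²` (`π' = 2u`) it is `−π'` and `X [+] (−π') = −π' − X` (tree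
`LubinTateColemanReflectionTwo`, `coe_tPt_ltDivPt_two`; Coleman's trace at `q = 2` is
`(𝒮h) ∘ f' = h + h(−π' − X)`, tree `LubinTateColemanTraceTwo`).  For the concrete comparison series
`ϑ = compSeriesC h2 hσ₀ u hε : F_{2X+X²} → F_{π'X+X²}` over `𝒪̂_{F^nr}` (`F` a local field with `|𝓀_F| = 2`
in which `2` is a uniformiser, e.g. `F = ℚ₂` via `Padic.isUniformizer_natCast 2`), evaluated on the open
unit ball `𝔪_ℂ ⊂ 𝒪_{ℂ_F}` (`maxNilIdealC F`), this file proves: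

* `coe_ltPoly_two_eq`, `ltF_ltPoly_two_eq`, ★ `coe_addPt_ltPoly_two` — `f₀ = 2X + X² = (1+X)² − 1`,
  **`F_{f₀} = X₀ + X₁ + X₀X₁`** (tree `ltF_one_add_X_pow_sub_one`), so **`x [+]_{f₀} y = x + y + xy`** on `𝔪_ℂ`;
  `LubinTate.ltF_congr` (the group law only depends on the series);
* `LubinTate.norm_sub_one_lt_one_of_pow_two_pow_eq_one` — `‖ε − 1‖ < 1` for every `2`-power root of unity
  `ε` when `‖2‖ < 1`; `LubinTate.nthRootsFinset_two_one` — `{w : w² = 1} = {1, −1}`;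
* ★ `coe_evalPt₁_compSeriesC_negTwo` — **`ϑ(−2) = −π'`** (`ϑ` is injective on `𝔪_ℂ` and carries
  `f₀`-torsion to `f'`-torsion, whose level-one points are `{0, −π'}`);
* `LubinTate.evalPt₁_evalPt_of_subst_eq`, `evalPt₁_homC'_addPt` — `[π']_{f'}` is an endomorphism of `F_{f'}`
  on `𝔪_ℂ` (Lubin–Tate (4) evaluated);
* ★★ `coe_evalPt₁_compSeriesC_reflect` — **`ϑ(−2 − x) = −π' − ϑ(x)`** for `x ∈ 𝔪_ℂ` (group law at points
  `evalPt₁_compSeriesC_addPt` + `ϑ(−2) = −π'` + the quadratic relation `f'(y [+] (−π')) = f'(y)` + injectivity);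
* ★★★ `evS_subst_compSeriesC_reflect` — **THE SEAM**: if `h ∈ 𝒪_{ℂ_F}⟦X⟧` satisfies `h(−π' − y) = −h(y)`
  on `𝔪_ℂ` then `H := h ∘ ϑ` satisfies `H(−2 − x) = −H(x)` on `𝔪_ℂ`;
* ★★★ `sum_nthRootsFinset_tsum_coeff_subst_compSeriesC_eq_zero` — hence
  **`Σ_{w ∈ nthRootsFinset 2 1} Σ_m H_m (εw − 1)^m = 0` for every `ε ∈ ℂ_F` with `ε^{2^n} = 1`**: the
  `Ĝ_m`-trace of `H` vanishes at the `2`-power torsion — verbatim the hypothesis `htrace` of the support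
  criterion `forall_invAmice₁_μ_eq_zero_of_nthRoots` / socket
  `integral_restrictUnits_density_unitInv_pow_succ_eq_constantCoeff` of `PAdicOneVariableTraceCriterion*.lean`
  (there over `ℂ_[p]`; here in the tree's `ℂ_F = CompletedAlgClosure F`).

Everything is proved; no named facts, no definitions, no instances, no `sorry`.

## References

* [deShalit1987] E. de Shalit, *Iwasawa theory of elliptic curves with complex multiplication* (1987),
  I.3.2 (3)–(5), I.3.3 (7)–(7′) (p. 17).
* [LubinTate1965] J. Lubin, J. Tate, *Formal complex multiplication in local fields*, Ann. of Math. 81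
  (1965), §1 Thm. 1 (4), (8); Lemma p. 385–386, (17)–(18).
* [CasselsFrohlichANT1967] J.-P. Serre, *Local class field theory*, Ch. VI of Cassels–Fröhlich (1967),
  §3.2 (points of formal groups).
-/

noncomputable section

open MvPowerSeries
open scoped PowerSeries.WithPiTopology

namespace Literature.NumberTheory.GaloisRepresentations

/-! ## `q = 2`: the reflection `x ↦ −2 − x` of `Ĝ_m(𝔪_ℂ)` goes to `y ↦ −π' − y` under `ϑ` -/

namespace LubinTate

section TwoPowRoots

variable {L : Type*} [NormedField L] [IsUltrametricDist L]

/-- In an ultrametric field of residue characteristic `2` (`‖2‖ < 1`), every `2`-power root of unity `ε`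
satisfies `‖ε − 1‖ < 1` (induction on the exponent: `(ε − 1)² = (ε² − 1) − 2(ε − 1)`).
[cite: deShalit1987, I.3.2 (5) (p. 17)] -/
theorem norm_sub_one_lt_one_of_pow_two_pow_eq_one (h2 : ‖(2 : L)‖ < 1) {n : ℕ} {ε : L}
    (hε : ε ^ 2 ^ n = 1) : ‖ε - 1‖ < 1 := by
  induction n generalizing ε with
  | zero =>
    rw [pow_zero, pow_one] at hε
    rw [hε, sub_self, norm_zero]; exact one_pos
  | succ n ih =>
    have hε2 : (ε ^ 2) ^ 2 ^ n = 1 := by rw [← pow_mul, ← pow_succ', hε]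
    have ih2 := ih hε2
    have hε1 : ‖ε‖ ≤ 1 := by
      have h : ‖ε‖ ^ 2 ^ (n + 1) = 1 := by rw [← norm_pow, hε, norm_one]
      exact (pow_eq_one_iff_of_nonneg (norm_nonneg ε) (pow_ne_zero _ two_ne_zero)).mp h |>.le
    have hle : ‖ε - 1‖ ≤ 1 := by
      rw [sub_eq_add_neg]
      refine (IsUltrametricDist.norm_add_le_max ε (-1)).trans ?_
      rw [norm_neg, norm_one]; exact max_le hε1 le_rfl
    by_contra hlt
    have heq : ‖ε - 1‖ = 1 := le_antisymm hle (not_lt.mp hlt)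
    have key : (ε - 1) ^ 2 = (ε ^ 2 - 1) + (-(2 * (ε - 1))) := by ring
    have h1 : ‖(ε - 1) ^ 2‖ < 1 := by
      rw [key]
      refine lt_of_le_of_lt (IsUltrametricDist.norm_add_le_max _ _) (max_lt ih2 ?_)
      rw [norm_neg, norm_mul, heq, mul_one]; exact h2
    rw [norm_pow, heq, one_pow] at h1
    exact lt_irrefl _ h1

/-- `{w : w² = 1} = {1, −1}` (as a finset, in any field). [cite: deShalit1987, I.3.3 (7′) (p. 17)] -/
theorem nthRootsFinset_two_one {K : Type*} [Field K] [DecidableEq K] :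
    Polynomial.nthRootsFinset 2 (1 : K) = {1, -1} := by
  ext w
  rw [Polynomial.mem_nthRootsFinset two_pos, Finset.mem_insert, Finset.mem_singleton, sq_eq_one_iff]

end TwoPowRoots

end LubinTate

section ReflectionTwo

open ValuativeRel IsLocalRing Field IsNonarchimedeanLocalField LubinTate
open Literature.NumberTheory.PAdicHodge

variable {F : Type} [Field F] [ValuativeRel F] [TopologicalSpace F] [IsNonarchimedeanLocalField F]
variable (hq : residueFieldCard F = 2) (h2 : (valuation F).IsUniformizer (((2 : ℕ) : 𝒪[F]) : F))
  {σ₀ : absoluteGaloisGroup F} (hσ₀ : IsAbsArithFrob σ₀) (u : 𝒪[F]ˣ)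
  {ε : (maxUnramifiedCompletion F)ˣ}
  (hε : maxUnramifiedCompletion.galAut F σ₀ (ε : maxUnramifiedCompletion F) =
    algebraMap 𝒪[F] (maxUnramifiedCompletion F) (u : 𝒪[F]) * (ε : maxUnramifiedCompletion F))

/-! ### The formal group of `f₀ = 2X + X²` is `Ĝ_m`: `x [+] y = x + y + xy` on `𝔪_ℂ` -/

include hq in
/-- At `|𝓀_F| = 2` the Lubin–Tate polynomial of `2` is `f₀ = 2X + X² = (1 + X)² − 1`.
[cite: deShalit1987, I.3.2 (p. 17)] -/
theorem coe_ltPoly_two_eq :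
    ((ltPoly F ((2 : ℕ) : 𝒪[F]) : Polynomial 𝒪[F]) : PowerSeries 𝒪[F]) =
      (1 + PowerSeries.X : PowerSeries 𝒪[F]) ^ 2 - 1 := by
  rw [ltPoly, hq, Polynomial.coe_add, Polynomial.coe_mul, Polynomial.coe_pow, Polynomial.coe_C,
    Polynomial.coe_X, map_natCast]
  ring

/-- Uniqueness of the Lubin–Tate group law: `F_f` only depends on the series `f` (not on the exponent
`q` or the proofs). [cite: LubinTate1965, §1 Thm. 1] -/
theorem LubinTate.ltF_congr {A : Type*} [CommRing A] {π : A} {q q' : ℕ} (hA : IsLTRing π q)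
    (hA' : IsLTRing π q') {f g : PowerSeries A} (hf : IsLTSeries π q f) (hg : IsLTSeries π q' g)
    (hfg : f = g) : ltF hA hf = ltF hA' hg := by
  subst hfg
  exact (eq_limit hA hf hf (constantCoeff_ltF hA' hg) (coeff_ltF_single hA' hg) (compLeft_ltF hA' hg)).symm

include hq in
/-- **`F_{f₀} = X₀ + X₁ + X₀X₁` at `|𝓀_F| = 2`, `f₀ = 2X + X²`**: the Lubin–Tate group of `2` is the
multiplicative group (tree `ltF_one_add_X_pow_sub_one` at `p = 2`). [cite: deShalit1987, I.3.2 (p. 17)] -/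
theorem ltF_ltPoly_two_eq :
    ltF (isLTRing_integer F h2) (isLTSeries_ltPoly F (π := ((2 : ℕ) : 𝒪[F]))) =
      MvPowerSeries.X 0 + MvPowerSeries.X 1 + MvPowerSeries.X 0 * MvPowerSeries.X 1 := by
  haveI : Fact (Nat.Prime 2) := ⟨Nat.prime_two⟩
  have hA2 : IsLTRing (((2 : ℕ) : 𝒪[F])) 2 := by
    have h := isLTRing_integer F h2
    rwa [hq] at h
  rw [ltF_congr (isLTRing_integer F h2) hA2 (isLTSeries_ltPoly F) (isLTSeries_one_add_X_pow_sub_one 2)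
    (coe_ltPoly_two_eq hq), ltF_one_add_X_pow_sub_one]

include hq in
/-- ★ **`x [+]_{f₀} y = x + y + xy` on `𝔪_ℂ`** (`f₀ = 2X + X²`, `|𝓀_F| = 2`): the points of the Lubin–Tate
group of `2` form the multiplicative group `(1 + 𝔪_ℂ) − 1`. [cite: deShalit1987, I.3.2 (3) (p. 17)] -/
theorem coe_addPt_ltPoly_two (x y : (maxNilIdealC F).toIdeal) :
    ((addPt (maxNilIdealC F)
        ((formalGroup (isLTRing_integer F h2) (isLTSeries_ltPoly F (π := ((2 : ℕ) : 𝒪[F])))).map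
          (intToUnrCoeff F)) x y : (maxNilIdealC F).toIdeal) : CBall F) =
      (x : CBall F) + y + x * y := by
  have hG : ((formalGroup (isLTRing_integer F h2) (isLTSeries_ltPoly F (π := ((2 : ℕ) : 𝒪[F])))).map
      (intToUnrCoeff F)).toPowerSeries =
      (MvPowerSeries.X 0 + MvPowerSeries.X 1 + MvPowerSeries.X 0 * MvPowerSeries.X 1 :
        MvPowerSeries (Fin 2) (UnrCoeff F)) := by
    rw [FormalGroup.map_toPowerSeries]
    change MvPowerSeries.map (intToUnrCoeff F) (ltF _ _) = _
    rw [ltF_ltPoly_two_eq hq h2, map_add, map_add, map_mul, MvPowerSeries.map_X, MvPowerSeries.map_X]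
  have h0 : (MvPowerSeries.X 0 + MvPowerSeries.X 1 + MvPowerSeries.X 0 * MvPowerSeries.X 1 :
      MvPowerSeries (Fin 2) (UnrCoeff F)).constantCoeff = 0 := by simp
  rw [addPt, evalPt_congr (maxNilIdealC F) hG _ h0, coe_evalPt, map_add, map_add, map_mul,
    aeval_X', aeval_X']
  rfl

/-! ### `ϑ(−2) = −π'` and `ϑ(−2 − x) = −π' − ϑ(x)` -/

include h2 in
/-- `2 ≠ 0` in `ℂ_F` (it is a uniformiser of `F`). [cite: deShalit1987, I.3.2 (p. 17)] -/
theorem two_ne_zero_C : (2 : CompletedAlgClosure F) ≠ 0 := by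
  have h : ((((2 : ℕ) : 𝒪[F]) : F)) ≠ 0 := h2.ne_zero
  have e : ((((2 : ℕ) : 𝒪[F]) : F)) = 2 := by norm_cast
  rw [e] at h
  rw [show (2 : CompletedAlgClosure F) = algebraMap F (CompletedAlgClosure F) 2 from (map_ofNat _ 2).symm]
  exact (map_ne_zero _).mpr h

include h2 in
/-- `‖2‖ < 1` in `ℂ_F`. [cite: deShalit1987, I.3.2 (p. 17)] -/
theorem norm_two_lt_one_C : ‖(2 : CompletedAlgClosure F)‖ < 1 := by
  letI := nontriviallyNormedField F
  have hv : valuation F (2 : F) < 1 := by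
    have h := h2.val_lt_one
    have e : ((((2 : ℕ) : 𝒪[F]) : F)) = 2 := by norm_cast
    rwa [e] at h
  rw [show (2 : CompletedAlgClosure F) = algebraMap F (CompletedAlgClosure F) 2 from (map_ofNat _ 2).symm,
    CompletedAlgClosure.norm_algebraMap]
  exact (norm_lt_one_iff F _).mpr hv

/-- Points of `𝔪_ℂ` have norm `< 1` (unfolding). [cite: CasselsFrohlichANT1967, Ch. VI §3.2] -/
theorem norm_coe_lt_one_of_mem (x : (maxNilIdealC F).toIdeal) : ‖((x : CBall F) : CompletedAlgClosure F)‖ < 1 :=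
  x.2

/-- Every element of `ℂ_F` of norm `< 1` is a point of `𝔪_ℂ`. [cite: CasselsFrohlichANT1967, Ch. VI §3.2] -/
theorem exists_pt_coe_eq {z : CompletedAlgClosure F} (hz : ‖z‖ < 1) :
    ∃ x : (maxNilIdealC F).toIdeal, ((x : CBall F) : CompletedAlgClosure F) = z :=
  ⟨⟨⟨z, (mem_unitBall_iff _).mpr hz.le⟩, hz⟩, rfl⟩

include hq in
/-- ★ **`ϑ(−2) = −π'`**: the comparison series carries the non-zero `2`-division point `−2` of `Ĝ_m`
(`ζ_1 − 1`, `ζ_1 = −1`) to the non-zero `f'`-division point `−π'` (`W_{f'}^1 = {0, −π'}` at `q = 2`);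
de Shalit's `ω_1 = θ(ζ_1 − 1)`. [cite: deShalit1987, I.3.2 (5) (p. 17)] -/
theorem coe_evalPt₁_compSeriesC_negTwo (t : (maxNilIdealC F).toIdeal)
    (ht : ((t : CBall F) : CompletedAlgClosure F) = -2) :
    (((evalPt₁ (maxNilIdealC F) (compSeriesC h2 hσ₀ u hε) (constantCoeff_compSeriesC h2 hσ₀ u hε) t :
        (maxNilIdealC F).toIdeal) : CBall F) : CompletedAlgClosure F) =
      -algebraMap F (CompletedAlgClosure F) ((((u : 𝒪[F]) * ((2 : ℕ) : 𝒪[F]) : 𝒪[F]) : F)) := by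
  set c : CompletedAlgClosure F :=
    algebraMap F (CompletedAlgClosure F) ((((u : 𝒪[F]) * ((2 : ℕ) : 𝒪[F]) : 𝒪[F]) : F)) with hc
  set w : CompletedAlgClosure F :=
    (((evalPt₁ (maxNilIdealC F) (compSeriesC h2 hσ₀ u hε) (constantCoeff_compSeriesC h2 hσ₀ u hε) t :
        (maxNilIdealC F).toIdeal) : CBall F) : CompletedAlgClosure F) with hw
  -- `f₀(−2) = 2·(−2) + (−2)² = 0`
  have ht0 : Polynomial.aeval ((t : CBall F) : CompletedAlgClosure F)
      ((ltPoly F ((2 : ℕ) : 𝒪[F])).map (algebraMap 𝒪[F] F)) = 0 := by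
    rw [ltPoly, hq, ht, Polynomial.aeval_def, Polynomial.eval₂_map, Polynomial.eval₂_add, Polynomial.eval₂_mul,
      Polynomial.eval₂_C, Polynomial.eval₂_X, Polynomial.eval₂_pow, Polynomial.eval₂_X, map_natCast]
    ring
  -- hence `f'(w) = c w + w² = 0`
  have hw0 := aeval_ltPoly'_compSeriesC_eq_zero h2 hσ₀ u hε t ht0
  rw [ltPoly, hq, Polynomial.aeval_def, Polynomial.eval₂_map] at hw0
  simp only [Polynomial.eval₂_add, Polynomial.eval₂_mul, Polynomial.eval₂_C, Polynomial.eval₂_X,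
    Polynomial.eval₂_pow, RingHom.comp_apply] at hw0
  change c * w + w ^ 2 = 0 at hw0
  -- `w ≠ 0` since `ϑ` is injective on `𝔪_ℂ` and `−2 ≠ 0`
  have hw_ne : w ≠ 0 := by
    intro hzero
    have hpt : evalPt₁ (maxNilIdealC F) (compSeriesC h2 hσ₀ u hε) (constantCoeff_compSeriesC h2 hσ₀ u hε) t =
        evalPt₁ (maxNilIdealC F) (compSeriesC h2 hσ₀ u hε) (constantCoeff_compSeriesC h2 hσ₀ u hε) 0 := by
      rw [evalPt₁_zero]
      exact Subtype.ext (Subtype.ext hzero)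
    have ht' := evalPt₁_injective _ (constantCoeff_compSeriesC h2 hσ₀ u hε)
      (isUnit_coeff_one_compSeriesC h2 hσ₀ u hε) hpt
    have : ((t : CBall F) : CompletedAlgClosure F) = 0 := by rw [ht']; rfl
    rw [ht, neg_eq_zero] at this
    exact two_ne_zero_C h2 this
  have hfac : w * (c + w) = 0 := by rw [← hw0]; ring
  rcases mul_eq_zero.mp hfac with h | h
  · exact absurd h hw_ne
  · exact eq_neg_of_add_eq_zero_right h

/-! ### `f'` is an endomorphism of `F_{f'}` on `𝔪_ℂ`; `ϑ(−2 − x) = −π' − ϑ(x)` -/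

/-- Evaluating an identity `φ(G(X₀,X₁)) = G'(φ(X₀), φ(X₁))` of series at a pair of points.
[cite: CasselsFrohlichANT1967, Ch. VI §3.2] -/
theorem LubinTate.evalPt₁_evalPt_of_subst_eq {A : Type*} [CommRing A] [UniformSpace A] [DiscreteUniformity A]
    {S : Type*} [CommRing S] [UniformSpace S] [IsUniformAddGroup S] [IsTopologicalRing S]
    [IsLinearTopology S S] [T2Space S] [CompleteSpace S] [Algebra A S] [ContinuousSMul A S]
    (M : NilIdeal S) (φ : PowerSeries A) (hφ : PowerSeries.constantCoeff φ = 0)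
    (G G' : MvPowerSeries (Fin 2) A) (hG : G.constantCoeff = 0) (hG' : G'.constantCoeff = 0)
    (key : PowerSeries.subst G φ =
      MvPowerSeries.subst ![PowerSeries.subst (MvPowerSeries.X 0 : MvPowerSeries (Fin 2) A) φ,
        PowerSeries.subst (MvPowerSeries.X 1 : MvPowerSeries (Fin 2) A) φ] G')
    (x y : M.toIdeal) :
    evalPt₁ M φ hφ (evalPt M G hG ![x, y]) = evalPt M G' hG' ![evalPt₁ M φ hφ x, evalPt₁ M φ hφ y] := by
  have hcX : ∀ s : Fin 2, (PowerSeries.subst (MvPowerSeries.X s : MvPowerSeries (Fin 2) A) φ).constantCoeff = 0 :=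
    fun s ↦ by
      rw [PowerSeries.subst_def]
      exact MvPowerSeries.constantCoeff_subst_eq_zero
        (MvPowerSeries.hasSubst_of_constantCoeff_zero fun _ => MvPowerSeries.constantCoeff_X s)
        (fun _ => MvPowerSeries.constantCoeff_X s) hφ
  have hc0 : ∀ s : Fin 2, ((![PowerSeries.subst (MvPowerSeries.X 0 : MvPowerSeries (Fin 2) A) φ,
      PowerSeries.subst (MvPowerSeries.X 1 : MvPowerSeries (Fin 2) A) φ]) s).constantCoeff = 0 :=
    fun s ↦ by fin_cases s <;> exact hcX _
  have hL0 : (PowerSeries.subst G φ).constantCoeff = 0 := by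
    rw [PowerSeries.subst_def]
    exact MvPowerSeries.constantCoeff_subst_eq_zero
      (MvPowerSeries.hasSubst_of_constantCoeff_zero fun _ => hG) (fun _ => hG) hφ
  have hR0 : (MvPowerSeries.subst ![PowerSeries.subst (MvPowerSeries.X 0 : MvPowerSeries (Fin 2) A) φ,
      PowerSeries.subst (MvPowerSeries.X 1 : MvPowerSeries (Fin 2) A) φ] G').constantCoeff = 0 :=
    constantCoeff_subst_zero hc0 hG'
  have hL := evalPt₁_subst M G hG φ hφ hL0 ![x, y]
  have hR := evalPt_subst M hc0 G' hG' hR0 ![x, y]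
  have e := evalPt_congr M key hL0 hR0 ![x, y]
  rw [hL, hR] at e
  have hs : ∀ s : Fin 2, evalPt M (PowerSeries.subst (MvPowerSeries.X s : MvPowerSeries (Fin 2) A) φ) (hcX s) ![x, y] =
      evalPt₁ M φ hφ (![x, y] s) := fun s ↦ by
    rw [evalPt₁_subst M (MvPowerSeries.X s : MvPowerSeries (Fin 2) A) (MvPowerSeries.constantCoeff_X s) φ hφ
      (hcX s) ![x, y], evalPt_X]
  convert e using 2
  funext s
  fin_cases s
  · exact (hs 0).symm
  · exact (hs 1).symm

/-- **`f'` is an endomorphism of `F_{f'}` on `𝔪_ℂ`**: `[π']_{f'}(y [+] w) = [π']_{f'} y [+] [π']_{f'} w`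
(`f' ∘ F_{f'} = F_{f'} ∘ (f' × f')`, Lubin–Tate (4), evaluated). [cite: LubinTate1965, §1 Thm. 1 (4), (8)] -/
theorem evalPt₁_homC'_addPt {π : 𝒪[F]} (hπ : (valuation F).IsUniformizer (π : F)) (v : 𝒪[F]ˣ)
    (y w : (maxNilIdealC F).toIdeal) :
    evalPt₁ (maxNilIdealC F) (homC' hπ v ((v : 𝒪[F]) * π)) (constantCoeff_homC' hπ v _)
        (addPt (maxNilIdealC F)
          ((formalGroup (isLTRing_unit_mul hπ v) (isLTSeries_ltPoly F (π := (v : 𝒪[F]) * π))).map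
            (intToUnrCoeff F)) y w) =
      addPt (maxNilIdealC F)
        ((formalGroup (isLTRing_unit_mul hπ v) (isLTSeries_ltPoly F (π := (v : 𝒪[F]) * π))).map
          (intToUnrCoeff F))
        (evalPt₁ (maxNilIdealC F) (homC' hπ v ((v : 𝒪[F]) * π)) (constantCoeff_homC' hπ v _) y)
        (evalPt₁ (maxNilIdealC F) (homC' hπ v ((v : 𝒪[F]) * π)) (constantCoeff_homC' hπ v _) w) := by
  set h𝒪' := isLTRing_unit_mul hπ v with h𝒪'def
  set hf' := isLTSeries_ltPoly F (π := (v : 𝒪[F]) * π) with hf'def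
  set G' : MvPowerSeries (Fin 2) (UnrCoeff F) := MvPowerSeries.map (intToUnrCoeff F) (ltF h𝒪' hf') with hG'def
  have hG'0 : G'.constantCoeff = 0 := by
    rw [hG'def, MvPowerSeries.constantCoeff_map, constantCoeff_ltF, map_zero]
  -- the series identity `f' ∘ F' = F' ∘ (f' × f')` over `𝒪[F]`, mapped to the discrete copy of `𝒪̂_{F^nr}`
  have key : PowerSeries.subst G' (homC' hπ v ((v : 𝒪[F]) * π)) =
      MvPowerSeries.subst ![PowerSeries.subst (MvPowerSeries.X 0 : MvPowerSeries (Fin 2) (UnrCoeff F))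
          (homC' hπ v ((v : 𝒪[F]) * π)),
        PowerSeries.subst (MvPowerSeries.X 1 : MvPowerSeries (Fin 2) (UnrCoeff F)) (homC' hπ v ((v : 𝒪[F]) * π))] G' := by
    have h0 := compLeft_ltF h𝒪' hf'
    rw [compLeft, compRight] at h0
    -- `[π']_{f'} = f'`, read on the discrete copy
    have hhom : homC' hπ v ((v : 𝒪[F]) * π) = PowerSeries.map (intToUnrCoeff F)
        (((ltPoly F ((v : 𝒪[F]) * π) : Polynomial 𝒪[F]) : PowerSeries 𝒪[F])) := by
      rw [homC', hom_self_eq]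
    have h1 := congrArg (MvPowerSeries.map (σ := Fin 2) (intToUnrCoeff F)) h0
    have hs1 : PowerSeries.HasSubst (ltF h𝒪' hf') :=
      PowerSeries.HasSubst.of_constantCoeff_zero (constantCoeff_ltF h𝒪' hf')
    have hcs : ∀ i : Fin 2, (PowerSeries.subst (MvPowerSeries.X i : MvPowerSeries (Fin 2) 𝒪[F])
        (((ltPoly F ((v : 𝒪[F]) * π) : Polynomial 𝒪[F]) : PowerSeries 𝒪[F]))).constantCoeff = 0 := by
      intro i
      rw [PowerSeries.subst_def]
      exact MvPowerSeries.constantCoeff_subst_eq_zero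
        (MvPowerSeries.hasSubst_of_constantCoeff_zero fun _ => MvPowerSeries.constantCoeff_X i)
        (fun _ => MvPowerSeries.constantCoeff_X i) hf'.constantCoeff_eq_zero
    have hs2 : MvPowerSeries.HasSubst (fun i : Fin 2 => PowerSeries.subst
        (MvPowerSeries.X i : MvPowerSeries (Fin 2) 𝒪[F])
        (((ltPoly F ((v : 𝒪[F]) * π) : Polynomial 𝒪[F]) : PowerSeries 𝒪[F]))) :=
      MvPowerSeries.hasSubst_of_constantCoeff_zero hcs
    rw [PowerSeries.map_subst hs1, MvPowerSeries.map_subst hs2, ← hhom] at h1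
    have hX : ∀ i : Fin 2, MvPowerSeries.map (intToUnrCoeff F)
        (PowerSeries.subst (MvPowerSeries.X i : MvPowerSeries (Fin 2) 𝒪[F])
          (((ltPoly F ((v : 𝒪[F]) * π) : Polynomial 𝒪[F]) : PowerSeries 𝒪[F]))) =
        PowerSeries.subst (MvPowerSeries.X i : MvPowerSeries (Fin 2) (UnrCoeff F)) (homC' hπ v ((v : 𝒪[F]) * π)) :=
      fun i => by
        rw [PowerSeries.map_subst (PowerSeries.HasSubst.of_constantCoeff_zero (MvPowerSeries.constantCoeff_X i)),
          MvPowerSeries.map_X, ← hhom]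
    have hfam : (fun i : Fin 2 => MvPowerSeries.map (intToUnrCoeff F)
        (PowerSeries.subst (MvPowerSeries.X i : MvPowerSeries (Fin 2) 𝒪[F])
          (((ltPoly F ((v : 𝒪[F]) * π) : Polynomial 𝒪[F]) : PowerSeries 𝒪[F])))) =
        ![PowerSeries.subst (MvPowerSeries.X 0 : MvPowerSeries (Fin 2) (UnrCoeff F)) (homC' hπ v ((v : 𝒪[F]) * π)),
          PowerSeries.subst (MvPowerSeries.X 1 : MvPowerSeries (Fin 2) (UnrCoeff F))
            (homC' hπ v ((v : 𝒪[F]) * π))] := by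
      funext i
      rw [hX i]
      fin_cases i <;> rfl
    rw [hfam] at h1
    exact h1
  exact evalPt₁_evalPt_of_subst_eq (maxNilIdealC F) _ (constantCoeff_homC' hπ v _) G' G' hG'0 hG'0 key y w

include hq in
/-- ★★ **`ϑ(−2 − x) = −π' − ϑ(x)` on `𝔪_ℂ`**: the comparison series carries the reflection `x ↦ x [+]_{Ĝ_m} (−2)
= −2 − x` (i.e. `1 + x ↦ −(1 + x)`) to the reflection `y ↦ y [+]_{f'} (−π') = −π' − y` through the non-zero
`2`-division points; this is de Shalit's `θ(ς(1+S) − 1) = θ(S) [+] ω` at `p = 2`, `ς = −1`.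
[cite: deShalit1987, I.3.3 (7)–(7′) (p. 17)] -/
theorem coe_evalPt₁_compSeriesC_reflect (x x' : (maxNilIdealC F).toIdeal)
    (hx' : ((x' : CBall F) : CompletedAlgClosure F) = -2 - ((x : CBall F) : CompletedAlgClosure F)) :
    (((evalPt₁ (maxNilIdealC F) (compSeriesC h2 hσ₀ u hε) (constantCoeff_compSeriesC h2 hσ₀ u hε) x' :
        (maxNilIdealC F).toIdeal) : CBall F) : CompletedAlgClosure F) =
      -algebraMap F (CompletedAlgClosure F) ((((u : 𝒪[F]) * ((2 : ℕ) : 𝒪[F]) : 𝒪[F]) : F)) -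
        (((evalPt₁ (maxNilIdealC F) (compSeriesC h2 hσ₀ u hε) (constantCoeff_compSeriesC h2 hσ₀ u hε) x :
          (maxNilIdealC F).toIdeal) : CBall F) : CompletedAlgClosure F) := by
  set c : CompletedAlgClosure F :=
    algebraMap F (CompletedAlgClosure F) ((((u : 𝒪[F]) * ((2 : ℕ) : 𝒪[F]) : 𝒪[F]) : F)) with hc
  -- the point `t = −2` and `x' = x [+]₀ t`
  obtain ⟨t, ht⟩ := exists_pt_coe_eq (F := F) (z := -2) (by rw [norm_neg]; exact norm_two_lt_one_C h2)
  have hadd : addPt (maxNilIdealC F)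
      ((formalGroup (isLTRing_integer F h2) (isLTSeries_ltPoly F (π := ((2 : ℕ) : 𝒪[F])))).map
        (intToUnrCoeff F)) x t = x' := by
    apply Subtype.ext; apply Subtype.ext
    rw [coe_addPt_ltPoly_two hq h2 x t]
    push_cast
    rw [ht, hx']; ring
  -- `ϑ x' = ϑ x [+]' ϑ t` and `ϑ t = −c`
  have key := evalPt₁_compSeriesC_addPt h2 hσ₀ u hε x t
  rw [hadd] at key
  have hw := coe_evalPt₁_compSeriesC_negTwo hq h2 hσ₀ u hε t ht
  set y := evalPt₁ (maxNilIdealC F) (compSeriesC h2 hσ₀ u hε) (constantCoeff_compSeriesC h2 hσ₀ u hε) x with hy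
  set w := evalPt₁ (maxNilIdealC F) (compSeriesC h2 hσ₀ u hε) (constantCoeff_compSeriesC h2 hσ₀ u hε) t with hwdef
  set Z := evalPt₁ (maxNilIdealC F) (compSeriesC h2 hσ₀ u hε) (constantCoeff_compSeriesC h2 hσ₀ u hε) x' with hZ
  change ((w : CBall F) : CompletedAlgClosure F) = -c at hw
  -- (i) `f'(w) = 0`, so `[π'](y [+] w) = [π'] y [+] 0 = [π'] y`
  have hfw : evalPt₁ (maxNilIdealC F) (homC' h2 u ((u : 𝒪[F]) * ((2 : ℕ) : 𝒪[F]))) (constantCoeff_homC' h2 u _) w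
      = 0 := by
    apply Subtype.ext; apply Subtype.ext
    rw [coe_evalPt₁_homC'_self h2 u w, ltPoly, hq, Polynomial.aeval_def, Polynomial.eval₂_map,
      Polynomial.eval₂_add, Polynomial.eval₂_mul, Polynomial.eval₂_C, Polynomial.eval₂_X, Polynomial.eval₂_pow,
      Polynomial.eval₂_X, RingHom.comp_apply, hw]
    change c * -c + (-c) ^ 2 = ((0 : CBall F) : CompletedAlgClosure F)
    push_cast; ring
  have hend := evalPt₁_homC'_addPt (F := F) h2 u y w
  rw [← key, hfw, addPt_zero_right'] at hend
  -- read in `ℂ_F`: `c Z + Z² = c y + y²`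
  have hval := congrArg (fun P : (maxNilIdealC F).toIdeal => ((P : CBall F) : CompletedAlgClosure F)) hend
  rw [coe_evalPt₁_homC'_self h2 u Z, coe_evalPt₁_homC'_self h2 u y, ltPoly, hq, Polynomial.aeval_def,
    Polynomial.eval₂_map, Polynomial.aeval_def, Polynomial.eval₂_map] at hval
  simp only [Polynomial.eval₂_add, Polynomial.eval₂_mul, Polynomial.eval₂_C, Polynomial.eval₂_X,
    Polynomial.eval₂_pow, RingHom.comp_apply] at hval
  change c * ((Z : CBall F) : CompletedAlgClosure F) + ((Z : CBall F) : CompletedAlgClosure F) ^ 2 =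
    c * ((y : CBall F) : CompletedAlgClosure F) + ((y : CBall F) : CompletedAlgClosure F) ^ 2 at hval
  have hfac : (((Z : CBall F) : CompletedAlgClosure F) - ((y : CBall F) : CompletedAlgClosure F)) *
      (((Z : CBall F) : CompletedAlgClosure F) + ((y : CBall F) : CompletedAlgClosure F) + c) = 0 := by
    linear_combination hval
  -- (ii) `Z ≠ y`: otherwise `x' = x`, i.e. `2(1 + x) = 0`, i.e. `x = −1 ∉ 𝔪_ℂ`
  have hne : ((Z : CBall F) : CompletedAlgClosure F) - ((y : CBall F) : CompletedAlgClosure F) ≠ 0 := by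
    intro h0
    have hZy : Z = y := Subtype.ext (Subtype.ext (sub_eq_zero.mp h0))
    have hxx : x' = x := evalPt₁_injective _ (constantCoeff_compSeriesC h2 hσ₀ u hε)
      (isUnit_coeff_one_compSeriesC h2 hσ₀ u hε) hZy
    have h1 : (2 : CompletedAlgClosure F) * (1 + ((x : CBall F) : CompletedAlgClosure F)) = 0 := by
      have := congrArg (fun P : (maxNilIdealC F).toIdeal => ((P : CBall F) : CompletedAlgClosure F)) hxx
      rw [hx'] at this
      linear_combination -this
    rcases mul_eq_zero.mp h1 with h | h
    · exact two_ne_zero_C h2 h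
    · have hx1 : ((x : CBall F) : CompletedAlgClosure F) = -1 := by linear_combination h
      have hlt := norm_coe_lt_one_of_mem (F := F) x
      rw [hx1, norm_neg, norm_one] at hlt
      exact lt_irrefl _ hlt
  have h3 := (mul_eq_zero.mp hfac).resolve_left hne
  linear_combination h3

/-! ### The seam: trace-zero for `f'` at `q = 2` goes to `Ĝ_m`-trace-zero of `h ∘ ϑ` -/

/-- `ϑ` read in `𝒪_{ℂ_F}⟦X⟧` has no constant term. [cite: LubinTate1965, Lemma p. 385] -/
theorem constantCoeff_map_compSeriesC {π : 𝒪[F]} (hπ : (valuation F).IsUniformizer (π : F)) :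
    PowerSeries.constantCoeff ((compSeriesC hπ hσ₀ u hε).map (algebraMap (UnrCoeff F) (CBall F))) = 0 := by
  rw [← PowerSeries.coeff_zero_eq_constantCoeff_apply, PowerSeries.coeff_map,
    PowerSeries.coeff_zero_eq_constantCoeff_apply, constantCoeff_compSeriesC, map_zero]

/-- The point `ϑ(z)` is the `evS`-value of `ϑ` read in `𝒪_{ℂ_F}⟦X⟧`. [cite: LubinTate1965, Lemma p. 385] -/
theorem evalPt₁_compSeriesC_eq_mk_evS {π : 𝒪[F]} (hπ : (valuation F).IsUniformizer (π : F))
    (z : (maxNilIdealC F).toIdeal) :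
    evalPt₁ (maxNilIdealC F) (compSeriesC hπ hσ₀ u hε) (constantCoeff_compSeriesC hπ hσ₀ u hε) z =
      ⟨evS (maxNilIdealC F) z ((compSeriesC hπ hσ₀ u hε).map (algebraMap (UnrCoeff F) (CBall F))),
        evS_mem_of_constantCoeff_eq_zero _ z (constantCoeff_map_compSeriesC hσ₀ u hε hπ)⟩ :=
  Subtype.ext (coe_evalPt₁_eq_evS_map (maxNilIdealC F) _ _ z)

include hq in
/-- ★★★ **THE SEAM (`q = 2`)**: if `h ∈ 𝒪_{ℂ_F}⟦X⟧` is ODD for the reflection of `F_{f'}`, i.e.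
`h(−π' − y) = −h(y)` on `𝔪_ℂ` (⟸ `𝒮_{f'} h = 0`, Coleman's trace: `(𝒮h) ∘ f' = h + h(X [+] (−π')) =
h + h(−π' − X)` at `q = 2`), then `H := h ∘ ϑ ∈ 𝒪_{ℂ_F}⟦S⟧` is odd for the reflection of `Ĝ_m`:
**`H(−2 − x) = −H(x)`** on `𝔪_ℂ` — de Shalit's (7) ⟹ (7′) transported along `θ : Ĝ_m ≃ F_{f'}`.
[cite: deShalit1987, I.3.3 (7)–(7′) (p. 17)] -/
theorem evS_subst_compSeriesC_reflect (h : PowerSeries (CBall F))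
    (hh : ∀ y y' : (maxNilIdealC F).toIdeal,
      ((y' : CBall F) : CompletedAlgClosure F) =
        -algebraMap F (CompletedAlgClosure F) ((((u : 𝒪[F]) * ((2 : ℕ) : 𝒪[F]) : 𝒪[F]) : F)) -
          ((y : CBall F) : CompletedAlgClosure F) →
      evS (maxNilIdealC F) y' h = -evS (maxNilIdealC F) y h)
    (x x' : (maxNilIdealC F).toIdeal)
    (hx' : ((x' : CBall F) : CompletedAlgClosure F) = -2 - ((x : CBall F) : CompletedAlgClosure F)) :
    evS (maxNilIdealC F) x'
        (PowerSeries.subst ((compSeriesC h2 hσ₀ u hε).map (algebraMap (UnrCoeff F) (CBall F))) h) =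
      -evS (maxNilIdealC F) x
        (PowerSeries.subst ((compSeriesC h2 hσ₀ u hε).map (algebraMap (UnrCoeff F) (CBall F))) h) := by
  have hθ0 := constantCoeff_map_compSeriesC hσ₀ u hε h2
  rw [evS_subst (maxNilIdealC F) x' hθ0 h, evS_subst (maxNilIdealC F) x hθ0 h,
    ← evalPt₁_compSeriesC_eq_mk_evS hσ₀ u hε h2 x', ← evalPt₁_compSeriesC_eq_mk_evS hσ₀ u hε h2 x]
  exact hh _ _ (coe_evalPt₁_compSeriesC_reflect hq h2 hσ₀ u hε x x' hx')

/-- The `evS`-value of `H ∈ 𝒪_{ℂ_F}⟦X⟧` at a point `z`, read in `ℂ_F`, is the sum `Σ_m H_m z^m`.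
[cite: CasselsFrohlichANT1967, Ch. VI §3.2] -/
theorem tsum_coeff_mul_pow_eq_evS (H : PowerSeries (CBall F)) (z : (maxNilIdealC F).toIdeal) :
    ∑' m : ℕ, ((PowerSeries.coeff m H : CBall F) : CompletedAlgClosure F) *
        ((z : CBall F) : CompletedAlgClosure F) ^ m =
      ((evS (maxNilIdealC F) z H : CBall F) : CompletedAlgClosure F) := by
  have h1 := (PowerSeries.hasSum_aeval ((maxNilIdealC F).isTopologicallyNilpotent _ z.2) H).map
    (CBall F).subtype continuous_subtype_val
  have h2 : HasSum (fun m : ℕ ↦ ((PowerSeries.coeff m H : CBall F) : CompletedAlgClosure F) *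
      ((z : CBall F) : CompletedAlgClosure F) ^ m)
      (((evS (maxNilIdealC F) z H : CBall F) : CompletedAlgClosure F)) := by
    convert h1 using 1
    · funext m
      simp only [Function.comp_apply, smul_eq_mul, Subring.subtype_apply, Subring.coe_mul, SubmonoidClass.coe_pow]
    · rfl
  exact h2.tsum_eq

include hq in
/-- ★★★ **THE SEAM, in the currency of the measure side**: under the same hypothesis on `h`, the series
`H := h ∘ ϑ ∈ 𝒪_{ℂ_F}⟦S⟧` satisfies **`Σ_{w² = 1} Σ_m H_m (εw − 1)^m = 0` for every `2`-power root of unity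
`ε ∈ ℂ_F`** — the `Ĝ_m`-trace of `H` vanishes at all `2`-power torsion points `ε − 1`, which is the hypothesis
of the support criterion `D_H(non-unit classes) = 0` (de Shalit (7′); tree `forall_invAmice₁_μ_eq_zero_of_nthRoots`).
[cite: deShalit1987, I.3.3 (7)–(7′) (p. 17)] -/
theorem sum_nthRootsFinset_tsum_coeff_subst_compSeriesC_eq_zero (h : PowerSeries (CBall F))
    (hh : ∀ y y' : (maxNilIdealC F).toIdeal,
      ((y' : CBall F) : CompletedAlgClosure F) =
        -algebraMap F (CompletedAlgClosure F) ((((u : 𝒪[F]) * ((2 : ℕ) : 𝒪[F]) : 𝒪[F]) : F)) -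
          ((y : CBall F) : CompletedAlgClosure F) →
      evS (maxNilIdealC F) y' h = -evS (maxNilIdealC F) y h)
    {ζ : CompletedAlgClosure F} {n : ℕ} (hζ : ζ ^ 2 ^ n = 1) :
    ∑ w ∈ Polynomial.nthRootsFinset 2 (1 : CompletedAlgClosure F),
      ∑' m : ℕ, ((PowerSeries.coeff m
          (PowerSeries.subst ((compSeriesC h2 hσ₀ u hε).map (algebraMap (UnrCoeff F) (CBall F))) h) : CBall F) :
            CompletedAlgClosure F) * (ζ * w - 1) ^ m = 0 := by
  classical
  set H := PowerSeries.subst ((compSeriesC h2 hσ₀ u hε).map (algebraMap (UnrCoeff F) (CBall F))) h with hH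
  have h2C := two_ne_zero_C (F := F) h2
  have hne : (1 : CompletedAlgClosure F) ≠ -1 := fun h1 ↦ h2C (by linear_combination h1)
  rw [nthRootsFinset_two_one, Finset.sum_pair hne, mul_one, mul_neg_one]
  -- the points `ζ − 1` and `−ζ − 1 = −2 − (ζ − 1)` of `𝔪_ℂ`
  have hx : ‖ζ - 1‖ < 1 := norm_sub_one_lt_one_of_pow_two_pow_eq_one (norm_two_lt_one_C h2) hζ
  have hx' : ‖-ζ - 1‖ < 1 := by
    rw [show -ζ - 1 = (ζ - 1) + -(2 * ζ) by ring]
    refine lt_of_le_of_lt (IsUltrametricDist.norm_add_le_max _ _) (max_lt hx ?_)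
    have hζ1 : ‖ζ‖ ≤ 1 := by
      have h : ‖ζ‖ ^ 2 ^ n = 1 := by rw [← norm_pow, hζ, norm_one]
      exact (pow_eq_one_iff_of_nonneg (norm_nonneg ζ) (pow_ne_zero _ two_ne_zero)).mp h |>.le
    rw [norm_neg, norm_mul]
    calc ‖(2 : CompletedAlgClosure F)‖ * ‖ζ‖ ≤ ‖(2 : CompletedAlgClosure F)‖ * 1 := by
          gcongr
      _ < 1 := by rw [mul_one]; exact norm_two_lt_one_C h2
  obtain ⟨x, hxe⟩ := exists_pt_coe_eq (F := F) hx
  obtain ⟨x', hx'e⟩ := exists_pt_coe_eq (F := F) hx'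
  have hxx' : ((x' : CBall F) : CompletedAlgClosure F) = -2 - ((x : CBall F) : CompletedAlgClosure F) := by
    rw [hxe, hx'e]; ring
  have key := evS_subst_compSeriesC_reflect hq h2 hσ₀ u hε h hh x x' hxx'
  rw [← hH] at key
  rw [← hxe, ← hx'e, tsum_coeff_mul_pow_eq_evS, tsum_coeff_mul_pow_eq_evS, key]
  push_cast
  ring

end ReflectionTwo

end Literature.NumberTheory.GaloisRepresentations

end
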